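import Summits.HodgeConjecture.HodgeConjecture.Theorems.R90S6TwistedTorusDescentCanonical      -- TB2a FILE 2c part A (this seat): §1 pinned twisted descent, §2 `quotientMeasure_setOf_descEpsConj_iwasawaExp_mul_eq`; brings ★ 2a, ★ 1c, ★ TJ1
import Summits.HodgeConjecture.HodgeConjecture.Theorems.R90S6TwistedConstantTermValue         -- ★ TB2a FILE 2b (this seat): (V2) `lintegral_prod_indicator_twistedConj_eq`, `measure_setOf_mul_mem_doubleCoset_eq`, `isOpen_doubleCoset_glInt`; brings ★ 1a
import Literature.NumberTheory.Automorphic.GLnLeviQuotientIwasawaConstant                     -- ★ `coe_mul_measure_eq_of_quotientMeasure_eq_smul_map` (the `K N A` constant PINNED by the `K̃`-masses)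
import HarnessLib

/-!
# R90 · S6 «Ch. 14.1–14.5 stable TF» — CARD TB2a FILE 2c PIN, part B (row E1.4.4.2.1 ∕ TB2d): THE ε-TWISTED ORBITAL INTEGRAL OF A HECKE SHELL AGAINST THE
# CANONICAL QUOTIENT MEASURE — THE CONSTANT OF (V4) EVALUATED: `Φ_ε(δ, 1_{K̃gK̃}; ν∕t) = (ν(K̃)∕t(T_ε ∩ K̃)) · J(δ) · Σ_{(n,m) ∈ ℤ²} #{γ ∈ K̃gK̃∕K̃ : e(γ) = e(δ) + (n, 2m, n)}`
# (`Theorems/R90S6TwistedConstantTermValuePinned.lean`)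

Cell `hodgecm-mathlib`, crux H413 (`stmt-HodgeConjecture-24833`), route of record `HCCMUnconditional`; programme R90-TF (brief `director/R90-BRIEF.v2.md`),
section S6 (base `R90-C14`), seat R90-C14-p06 (g2); dealer R90-C14-plan (g2) 03:15:27Z («TB2a FILE 2c PIN → p06»: the canonical-quotient edition of ★ FILE 2b's
(V4) `exists_lintegral_descEpsConj_indicator_doubleCoset_eq_mul_tsum` with its constant `c` and the volume `μAT(U₀)` EVALUATED, so that the TB2d FILE C seam
(★ `R90S6TwistedHyperbolicHeckeFLValue`, R90-C14-p04 (g2)) can be re-run with no unpinned measure letter).  Lane `--kind proof --supports stmt-HodgeConjecture-24833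
--as helper`; THEOREMS ONLY (no definition ∕ instance ∕ notation ∕ named fact ∕ `sorry`).  Junction bytes of ★ 2a ∕ ★ 2b ∕ ★ TJ1 ∕ ★ TB2d are untouched.

THE MATHEMATICS [Rogawski1990, §4.10 (4.10.1)–Prop. 4.10.2 pp. 57–59, §4.3 (4.3.1) p. 43, §4.13 pp. 64–70; DeitmarEchterhoff2014 Thm. 1.5.3].
Frame of ★ 2b's (V4) (`ε = Θ_σ` via `hεΘ`, `ε K̃ ⊆ K̃` via `hεK`, `δ = diag(d)` ε-regular `ha hb`, `T = G̃_{δε} ≤ A = M_{id}` closed `hT hTA hAid hA`), with the three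
invariant measures REPLACED by the canonical quotients of Haar measures: `ν` on `GL₃(K)` (right invariant), `t` on `T` (inversion invariant), and — AUXILIARY DATA not
occurring in the value — `α` on `A` (right and inversion invariant), `t′` the transport of `t` to `T ≤ A` (`ht'`, ★ CanonicalOne's currency).
* (V4-PIN) HEAD **`lintegral_descEpsConj_indicator_doubleCoset_quotientMeasure_eq`**: for EVERY `g`,
  `∫⁻ 1_{K̃gK̃}(y δ ε(y)⁻¹) d(ν∕t)(y) = (ν(K̃) ∕ t(T ∩ K̃)) · J(δ) · Σ'_{(n,m) ∈ ℤ × ℤ} #{γ ∈ K̃gK̃∕K̃ : e(γ) = e(δ) + (n, 2m, n)}`,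
  `J(δ) = (‖d₂∕d₁·σ(d₁∕d₀) − 1‖ · √‖1 − d₂∕d₀·σ(d₂∕d₀)‖)⁻¹` — part A §1 with the `K N A` letter DISCHARGED (★ `exists_quotientMeasure_torus_eq_smul_map`) and its
  constant PINNED (★ `coe_mul_measure_eq_of_quotientMeasure_eq_smul_map`: `C · κ(K̃) μ_N(Ñ₀) · α(A ∩ K̃) = ν(K̃)`), ★ TJ1's Jacobian, ★ 2b (V2) at the diagonal points,
  ★ 2a's fibre sum and part A §2 (`μAT(U₀) · t(T ∩ K̃) = α(A ∩ K̃)`):  `c·C·κ(K̃)μ_N(Ñ₀)·μAT(U₀) = 1·[ν(K̃)∕α(A₀)]·[α(A₀)∕t(T₀)]` — `κ`, `μ_N`, `α` CANCEL.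
* (V4-ONE) **`lintegral_descEpsConj_indicator_doubleCoset_quotientMeasure_eq_of_measure_eq_one`**: at Rogawski's normalisation `ν(K̃) = 1`, `t(T ∩ K̃) = 1` (§4.3)
  the value is `J(δ) · Σ'` — no measure constant at all.

HONEST LABEL: `α`, `t′` remain auxiliary hypotheses (★ CanonicalOne §2's convention); ε-regularity, `T ≤ A` closed, `ε = Θ_σ`, `ε K̃ ⊆ K̃` stay binders as in ★ 2b.
Count-neutral bookkeeping until TB2d consumes it; proves no printed statement, discharges no citation.  HC_CM is proved only modulo the 7 printed citations
(2 remaining named inputs: hLiu418 = stmt-HodgeConjecture-24832, h413 = stmt-HodgeConjecture-24833) until rung 0 closes; REL ≠ ★ ≠ BUILT.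

## Tree search
Part A (§1, §2); ★ 2b (V2) `lintegral_prod_indicator_twistedConj_eq`, `measure_setOf_mul_mem_doubleCoset_eq`, `isOpen_doubleCoset_glInt`; ★ 2a
`lintegral_descEpsConj_comp_iwasawaExp_eq_mul_tsum`, `coe_mul_mul_qsInvolution_inv_of_diagonal`; ★ TJ1 `lintegral_twistedTorusOrbit_hJac`; ★
`GLnUnipotentRadicalUnimodular.exists_quotientMeasure_torus_eq_smul_map`; ★ `GLnLeviQuotientIwasawaConstant.coe_mul_measure_eq_of_quotientMeasure_eq_smul_map`;
★ `TorusOrbitalDescentUnitCanonical.coe_mul_measure_mul_measure_eq_one_of_quotientMeasure_eq_smul_map` (the untwisted twin); Mathlib `Measure.haar`, `ENNReal.eq_div_iff`,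
`mul_div_assoc`.  Dedup: `rg "indicator_doubleCoset_quotientMeasure"` — no hit.

## References
* [Rogawski1990] J. D. Rogawski, *Automorphic Representations of Unitary Groups in Three Variables*, Ann. of Math. Stud. 123 (1990), §4.3 p. 43, §4.10 pp. 57–59,
  §4.13 pp. 64–70.
* [DeitmarEchterhoff2014] A. Deitmar, S. Echterhoff, *Principles of Harmonic Analysis*, 2nd ed. (2014), Thm. 1.5.3.
* [Kottwitz1986BaseChangeUnits] R. Kottwitz, *Base change for unit elements of Hecke algebras*, Compositio Math. 60 (1986), §1 pp. 239–240, §3.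
-/

set_option autoImplicit false
-- the mandated namespace repeats the single-problem summit's segment (`HodgeConjecture.HodgeConjecture`)
set_option linter.dupNamespace false

noncomputable section

open MeasureTheory Measure Set Function Filter Topology
open scoped ENNReal NNReal Pointwise MatrixGroups
open ValuativeRel MulAction Finset
open Literature.NumberTheory.Automorphic Literature.MeasureTheory.Group Literature.NumberTheory.Rogawski1990.Ch4Sec10
open Literature.NumberTheory.GaloisRepresentations Literature.NumberTheory.GaloisRepresentations.IsNonarchimedeanLocalField
open Literature.NumberTheory.Automorphic.heckeAlgebra

namespace Summit.HodgeConjecture.HodgeConjecture.R90.S6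

/-! ## (V4-PIN) The value against `ν∕t`: the constant is `ν(K̃) ∕ t(T ∩ K̃)` -/

section Value

variable {K : Type*} [Field K] [ValuativeRel K] [TopologicalSpace K] [IsNonarchimedeanLocalField K]
  [MeasurableSpace K] [BorelSpace K] [IsDiscreteValuationRing 𝒪[K]] {ϖ : K} (hϖ : IsUniformizingElement ϖ)
  [MeasurableSpace (GL (Fin 3) K)] [BorelSpace (GL (Fin 3) K)]
  (σ : K →+* K) (hσ : ∀ x, σ (σ x) = x) (hσc : Continuous σ)
  (ε : GL (Fin 3) K →* GL (Fin 3) K) (hε : Continuous ε) (hεΘ : ∀ g, ε g = UnitaryGroup.qsInvolution σ g)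
  (hεK : ∀ k ∈ glInt 3 K, ε k ∈ glInt 3 K)
  (δ : GL (Fin 3) K) (d : Fin 3 → K) (hδ : (δ : Matrix (Fin 3) (Fin 3) K) = Matrix.diagonal d)

omit [ValuativeRel K] [TopologicalSpace K] [IsNonarchimedeanLocalField K] [MeasurableSpace K] [BorelSpace K] [IsDiscreteValuationRing 𝒪[K]]
  [MeasurableSpace (GL (Fin 3) K)] [BorelSpace (GL (Fin 3) K)] in
/-- `descEpsConj ε δ G_{δε} φ (g G_{δε}) = φ(g δ ε(g)⁻¹)` (local copy of ★ 1c's private lemma). [cite: Rogawski1990, §1.6 p. 5] -/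
private theorem descEpsConj_apply_mk_pinned {β : Type*} (φ : GL (Fin 3) K → β) (g : GL (Fin 3) K) :
    descEpsConj ε δ (epsCentralizer ε δ) φ (QuotientGroup.mk g : GL (Fin 3) K ⧸ epsCentralizer ε δ) = φ (g * δ * (ε g)⁻¹) := by
  obtain ⟨m, hm⟩ := QuotientGroup.mk_out_eq_mul (epsCentralizer ε δ) g
  have hmδ : (m : GL (Fin 3) K) * δ * (ε (m : GL (Fin 3) K))⁻¹ = δ := (mem_epsCentralizer_iff ε δ _).1 m.2
  unfold descEpsConj
  rw [hm, map_mul]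
  congr 1
  calc g * (m : GL (Fin 3) K) * δ * (ε g * ε (m : GL (Fin 3) K))⁻¹ = g * ((m : GL (Fin 3) K) * δ * (ε (m : GL (Fin 3) K))⁻¹) * (ε g)⁻¹ := by group
    _ = g * δ * (ε g)⁻¹ := by rw [hmδ]

omit [ValuativeRel K] [TopologicalSpace K] [IsNonarchimedeanLocalField K] [MeasurableSpace K] [BorelSpace K] [IsDiscreteValuationRing 𝒪[K]]
  [MeasurableSpace (GL (Fin 3) K)] [BorelSpace (GL (Fin 3) K)] in
/-- an element of the diagonal torus has a diagonal matrix (local copy of ★ 2a's private lemma). [folklore] -/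
private theorem coe_eq_diagonal_of_mem_standardLeviGL_pinned {a : GL (Fin 3) K} (ha : a ∈ standardLeviGL K (_root_.id : Fin 3 → Fin 3)) :
    (a : Matrix (Fin 3) (Fin 3) K) = Matrix.diagonal fun i => (a : Matrix (Fin 3) (Fin 3) K) i i := by
  ext i j
  by_cases hij : i = j
  · subst hij; rw [Matrix.diagonal_apply_eq]
  · rw [Matrix.diagonal_apply_ne _ hij]
    exact (mem_standardLeviGL_iff (_root_.id : Fin 3 → Fin 3) a).1 ha i j hij

include hϖ hσ hσc hε hεΘ hεK hδ in
/-- **(V4-PIN) THE ε-TWISTED ORBITAL INTEGRAL OF A HECKE SHELL AGAINST THE CANONICAL QUOTIENT MEASURE `ν∕t`.**  In the frame of ★ 2b's (V4) (`ε = Θ_σ`,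
`ε K̃ ⊆ K̃`, `δ = diag(d)` ε-regular, `T = G̃_{δε} ≤ A = M_{id}` closed), let `ν` be a Haar measure on `GL₃(K)` (right invariant), `t` a Haar measure on `T`
(inversion invariant), and — AUXILIARY DATA not occurring on the right — `α` a Haar measure on `A` (right and inversion invariant), `t′` the transport of `t`
to `T ≤ A` (`ht'`).  Then FOR EVERY `g ∈ GL₃(K)`, with `S = K̃ g K̃`, `e = iwasawaExp hϖ`, `J(δ) = (‖d₂∕d₁·σ(d₁∕d₀) − 1‖ · √‖1 − d₂∕d₀·σ(d₂∕d₀)‖)⁻¹`: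
**`∫⁻ 1_S(y δ ε(y)⁻¹) d(ν∕t)(y) = (ν(K̃) ∕ t(T ∩ K̃)) · J(δ) · Σ'_{(n,m) ∈ ℤ × ℤ} #{γ ∈ K̃gK̃ ∕ K̃ : e(γ) = e(δ) + (n, 2m, n)}`** — §1 with the `K N A` letter
supplied by ★ `exists_quotientMeasure_torus_eq_smul_map` and PINNED by ★ `coe_mul_measure_eq_of_quotientMeasure_eq_smul_map` (`C·κ(K̃)μ_N(Ñ₀)·α(A ∩ K̃) = ν(K̃)`),
★ TJ1's Jacobian, ★ 2b (V2) at the diagonal points `aδε(a)⁻¹`, ★ 2a's ε-norm fibre sum, and §2 (`μAT(U₀)·t(T ∩ K̃) = α(A ∩ K̃)`): the auxiliary masses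
`κ(K̃)`, `μ_N(Ñ₀)`, `α(A ∩ K̃)` cancel.
[cite: Rogawski1990, §4.10 (4.10.1) p. 57, Prop. 4.10.2 proof p. 59; §4.3 (4.3.1) p. 43; §4.13 p. 70] [cite: Kottwitz1986BaseChangeUnits, §1 pp. 239–240, §3]
[cite: DeitmarEchterhoff2014, Thm. 1.5.3] -/
theorem lintegral_descEpsConj_indicator_doubleCoset_quotientMeasure_eq (hσ1 : ∃ x, σ x ≠ x)
    [T2Space (GL (Fin 3) K)] [SecondCountableTopology (GL (Fin 3) K)] [LocallyCompactSpace (GL (Fin 3) K)]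
    [IsHeckeTriple (⊤ : Submonoid (GL (Fin 3) K)) (glInt 3 K) (glInt 3 K)]
    (ha : d 2 / d 1 * σ (d 1 / d 0) - 1 ≠ 0) (hb : 1 - d 2 / d 0 * σ (d 2 / d 0) ≠ 0)
    {A : Subgroup (GL (Fin 3) K)} (hAid : A = standardLeviGL K (_root_.id : Fin 3 → Fin 3)) (hA : IsClosed (A : Set (GL (Fin 3) K)))
    (hT : IsClosed (epsCentralizer ε δ : Set (GL (Fin 3) K))) (hTA : epsCentralizer ε δ ≤ A)
    [MeasurableSpace (GL (Fin 3) K ⧸ epsCentralizer ε δ)] [BorelSpace (GL (Fin 3) K ⧸ epsCentralizer ε δ)]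
    [MeasurableSpace (GL (Fin 3) K ⧸ A)] [BorelSpace (GL (Fin 3) K ⧸ A)]
    [MeasurableSpace (↥A ⧸ (epsCentralizer ε δ).subgroupOf A)] [BorelSpace (↥A ⧸ (epsCentralizer ε δ).subgroupOf A)]
    (ν : Measure (GL (Fin 3) K)) [IsHaarMeasure ν] [ν.IsMulRightInvariant]
    (α : Measure ↥A) [IsHaarMeasure α] [α.IsMulRightInvariant] [α.IsInvInvariant]
    (t : Measure ↥(epsCentralizer ε δ)) [IsHaarMeasure t] [t.IsInvInvariant]
    (t' : Measure ↥((epsCentralizer ε δ).subgroupOf A)) [IsHaarMeasure t'] [t'.IsInvInvariant]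
    (ht' : t' = Measure.map (Subgroup.subgroupOfEquivOfLe hTA).symm t) (g : GL (Fin 3) K) :
    ∫⁻ y, descEpsConj ε δ (epsCentralizer ε δ)
        (((glInt 3 K : Set (GL (Fin 3) K)) * {g} * (glInt 3 K : Set (GL (Fin 3) K))).indicator (1 : GL (Fin 3) K → ℝ≥0∞)) y
        ∂(quotientMeasure (epsCentralizer ε δ) t hT ν) =
      ν (glInt 3 K : Set (GL (Fin 3) K)) / t (Subtype.val ⁻¹' (glInt 3 K : Set (GL (Fin 3) K))) *
        ((((normAbs K (d 2 / d 1 * σ (d 1 / d 0) - 1))⁻¹ * (NNReal.sqrt (normAbs K (1 - d 2 / d 0 * σ (d 2 / d 0))))⁻¹ : ℝ≥0)) : ℝ≥0∞) *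
        ∑' p : ℤ × ℤ, (#((finite_orbit_quotient (glInt 3 K) g).toFinset.filter
          fun γ => iwasawaExp hϖ γ.out = iwasawaExp hϖ δ + ![p.1, 2 * p.2, p.1]) : ℝ≥0∞) := by
  haveI : T2Space K := (isLocalField K).toT2Space
  haveI : BorelSpace ↥(glInt 3 K) := Subtype.borelSpace _
  haveI : BorelSpace ↥(upperUnitriangular (Fin 3) K) := Subtype.borelSpace _
  haveI : CompactSpace ↥(glInt 3 K) := isCompact_iff_compactSpace.1 (isCompact_glInt 3 K)
  haveI : SecondCountableTopology ↥(upperUnitriangular (Fin 3) K) := TopologicalSpace.Subtype.secondCountableTopology _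
  haveI : LocallyCompactSpace ↥(upperUnitriangular (Fin 3) K) := (isClosed_upperUnitriangular (R := K) (n := 3)).locallyCompactSpace
  haveI : IsClosed (A : Set (GL (Fin 3) K)) := hA
  haveI : LocallyCompactSpace ↥A := hA.isClosedEmbedding_subtypeVal.locallyCompactSpace
  haveI : SecondCountableTopology ↥A := TopologicalSpace.Subtype.secondCountableTopology _
  haveI : SFinite α := inferInstance
  haveI : IsClosed ((epsCentralizer ε δ : Subgroup (GL (Fin 3) K)) : Set (GL (Fin 3) K)) := hT
  haveI : BorelSpace ↥(epsCentralizer ε δ) := Subtype.borelSpace _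
  haveI : SecondCountableTopology ↥(epsCentralizer ε δ) := TopologicalSpace.Subtype.secondCountableTopology _
  haveI : LocallyCompactSpace ↥(epsCentralizer ε δ) := hT.isClosedEmbedding_subtypeVal.locallyCompactSpace
  haveI : IsClosed (((epsCentralizer ε δ).subgroupOf A : Subgroup ↥A) : Set ↥A) := isClosed_subgroupOf (epsCentralizer ε δ) A hT
  haveI : BorelSpace ↥((epsCentralizer ε δ).subgroupOf A) := Subtype.borelSpace _
  haveI : SecondCountableTopology ↥((epsCentralizer ε δ).subgroupOf A) := TopologicalSpace.Subtype.secondCountableTopology _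
  haveI : LocallyCompactSpace ↥((epsCentralizer ε δ).subgroupOf A) :=
    (isClosed_subgroupOf (epsCentralizer ε δ) A hT).isClosedEmbedding_subtypeVal.locallyCompactSpace
  haveI : SFinite t' := inferInstance
  -- auxiliary Haar measures on `K̃` and `Ñ` (they cancel)
  set κ : Measure ↥(glInt 3 K) := Measure.haar with hκ
  set μN : Measure ↥(upperUnitriangular (Fin 3) K) := Measure.haar with hμN
  haveI : IsFiniteMeasure κ := CompactSpace.isFiniteMeasure
  haveI : SFinite μN := inferInstance
  -- the `K N A` letter for the canonical `ν∕α` (★ `exists_quotientMeasure_torus_eq_smul_map`; `Ñ = U_{id}` by definition: re-key the Haar instance)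
  have hμNH : IsHaarMeasure μN := inferInstance
  unfold upperUnitriangular at hμNH
  obtain ⟨C, -, hq⟩ := @exists_quotientMeasure_torus_eq_smul_map K _ _ _ _ 3 _ _ A hAid _ _ (quotientMeasure A α hA ν) _ _
    (quotientMeasure_ne_zero A α hA ν) κ _ μN hμNH
  -- its constant PINNED: `C · κ(K̃) μ_N(Ñ₀) · α(A ∩ K̃) = ν(K̃)`
  have hμNs : SFinite μN := inferInstance
  unfold upperUnitriangular at hμNs
  have hpin : (C : ℝ≥0∞) * (κ Set.univ * μN {u : ↥(upperUnitriangular (Fin 3) K) | (u : GL (Fin 3) K) ∈ glInt 3 K}) *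
      α {a : ↥A | (a : GL (Fin 3) K) ∈ glInt 3 K} = ν (glInt 3 K : Set (GL (Fin 3) K)) :=
    @coe_mul_measure_eq_of_quotientMeasure_eq_smul_map K _ _ _ _ 3 (Fin 3) _ _ (_root_.id : Fin 3 → Fin 3) _ _ _ _ _ A hAid hA _ _ ν _ _
      α _ _ κ μN hμNs C hq
  -- the same letter in the `upperUnitriangular` currency of ★ 1c ∕ ★ TJ1 ∕ ★ 2b (`Ñ = U_{id}` by definition)
  have hq' : quotientMeasure A α hA ν = C • Measure.map (fun p : ↥(glInt 3 K) × ↥(upperUnitriangular (Fin 3) K) =>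
      (QuotientGroup.mk ((p.1 : GL (Fin 3) K) * (p.2 : GL (Fin 3) K)) : GL (Fin 3) K ⧸ A)) (κ.prod μN) := hq
  -- the Jacobian letter (★ TJ1)
  have hJac : ∀ a : ↥A, ∀ Φ : GL (Fin 3) K → ℝ≥0∞, Measurable Φ →
      ∫⁻ u, Φ ((u : GL (Fin 3) K) * ((a : GL (Fin 3) K) * δ * (ε (a : GL (Fin 3) K))⁻¹) * (ε (u : GL (Fin 3) K))⁻¹) ∂μN =
        ((((normAbs K (d 2 / d 1 * σ (d 1 / d 0) - 1))⁻¹ * (NNReal.sqrt (normAbs K (1 - d 2 / d 0 * σ (d 2 / d 0))))⁻¹ : ℝ≥0)) : ℝ≥0∞) *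
          ∫⁻ u, Φ (((a : GL (Fin 3) K) * δ * (ε (a : GL (Fin 3) K))⁻¹) * (u : GL (Fin 3) K)) ∂μN := by
    intro a Φ hΦ
    simp only [hεΘ]
    exact lintegral_twistedTorusOrbit_hJac σ hσ hσc hσ1 δ d hδ ha hb μN hAid a Φ hΦ
  set S : Set (GL (Fin 3) K) := (glInt 3 K : Set (GL (Fin 3) K)) * {g} * (glInt 3 K : Set (GL (Fin 3) K)) with hS
  have hSmeas : Measurable (S.indicator (1 : GL (Fin 3) K → ℝ≥0∞)) := measurable_one.indicator (isOpen_doubleCoset_glInt g).measurableSet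
  -- §1: the pinned descent
  rw [lintegral_descEpsConj_quotientMeasure_eq_mul_lintegral_torus_of_eq_smul_map ε δ κ μN hε hA hT hTA ν α t t' ht' hq' hJac hSmeas]
  -- ★ 2b (V2) at the diagonal points `a δ ε(a)⁻¹`
  set G : (Fin 3 → ℤ) → ℝ≥0∞ := fun v => (#((finite_orbit_quotient (glInt 3 K) g).toFinset.filter fun γ => iwasawaExp hϖ γ.out = v) : ℝ≥0∞) with hG
  have hmemA : ∀ a : ↥A, (a : GL (Fin 3) K) ∈ standardLeviGL K (_root_.id : Fin 3 → Fin 3) := fun a => hAid ▸ a.2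
  have hpt_mem : ∀ a : ↥A, (a : GL (Fin 3) K) * δ * (ε (a : GL (Fin 3) K))⁻¹ ∈ standardParabolicGL K (_root_.id : Fin 3 → Fin 3) := by
    intro a
    refine standardLeviGL_le K (_root_.id : Fin 3 → Fin 3) ((mem_standardLeviGL_iff (_root_.id : Fin 3 → Fin 3) _).2 fun i j hij => ?_)
    rw [hεΘ, coe_mul_mul_qsInvolution_inv_of_diagonal σ (coe_eq_diagonal_of_mem_standardLeviGL_pinned (hmemA a)) hδ]
    exact Matrix.diagonal_apply_ne _ hij
  have hinner : ∀ z : ↥A ⧸ (epsCentralizer ε δ).subgroupOf A,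
      descEpsConj ε δ (epsCentralizer ε δ)
          (fun m => ∫⁻ q : ↥(glInt 3 K) × ↥(upperUnitriangular (Fin 3) K),
            S.indicator (1 : GL (Fin 3) K → ℝ≥0∞) ((q.1 : GL (Fin 3) K) * (m * (q.2 : GL (Fin 3) K)) * (ε (q.1 : GL (Fin 3) K))⁻¹) ∂(κ.prod μN))
          (inclQuot (epsCentralizer ε δ) A z) =
        (κ Set.univ * μN {u : ↥(upperUnitriangular (Fin 3) K) | (u : GL (Fin 3) K) ∈ glInt 3 K}) *
          descEpsConj ε δ (epsCentralizer ε δ) (fun m => G (iwasawaExp hϖ m)) (inclQuot (epsCentralizer ε δ) A z) := by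
    intro z
    induction z using QuotientGroup.induction_on with
    | H a =>
      simp only [inclQuot_mk, descEpsConj_apply_mk_pinned ε δ]
      rw [lintegral_prod_indicator_twistedConj_eq ε hεK g _ κ μN, measure_setOf_mul_mem_doubleCoset_eq hϖ μN g (hpt_mem a)]
      simp only [hG, mul_assoc]
  simp_rw [hinner]
  have hN0fin : μN {u : ↥(upperUnitriangular (Fin 3) K) | (u : GL (Fin 3) K) ∈ glInt 3 K} ≠ ∞ := by
    have hcpt : IsCompact {u : ↥(upperUnitriangular (Fin 3) K) | (u : GL (Fin 3) K) ∈ glInt 3 K} :=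
      Topology.IsClosedEmbedding.subtypeVal (isClosed_upperUnitriangular (R := K) (n := 3)) |>.isCompact_preimage (isCompact_glInt 3 K)
    exact hcpt.measure_lt_top.ne
  rw [lintegral_const_mul' _ _ (ENNReal.mul_ne_top (measure_ne_top κ _) hN0fin),
    lintegral_descEpsConj_comp_iwasawaExp_eq_mul_tsum hϖ σ hσ hσc ε hε hεΘ δ d hδ hAid hTA
      (quotientMeasure ((epsCentralizer ε δ).subgroupOf A) t' (isClosed_subgroupOf (epsCentralizer ε δ) A hT) α) G]
  -- §2: `μAT(U₀) · t(T ∩ K̃) = α(A ∩ K̃)`; the masses of `A ∩ K̃`, `T ∩ K̃` are positive and finite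
  have hU := quotientMeasure_setOf_descEpsConj_iwasawaExp_mul_eq hϖ σ hσ hσc ε hεΘ δ d hδ hAid hA hT hTA α t t' ht'
  have hA0 : α {a : ↥A | (a : GL (Fin 3) K) ∈ glInt 3 K} ≠ 0 :=
    (((isOpen_glInt 3 K).preimage continuous_subtype_val).measure_pos α ⟨1, (glInt 3 K).one_mem⟩).ne'
  have hA0' : α {a : ↥A | (a : GL (Fin 3) K) ∈ glInt 3 K} ≠ ∞ :=
    (hA.isClosedEmbedding_subtypeVal.isCompact_preimage (isCompact_glInt 3 K)).measure_lt_top.ne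
  have ht0 : t (Subtype.val ⁻¹' (glInt 3 K : Set (GL (Fin 3) K))) ≠ 0 :=
    (((isOpen_glInt 3 K).preimage continuous_subtype_val).measure_pos t ⟨1, (glInt 3 K).one_mem⟩).ne'
  have ht0' : t (Subtype.val ⁻¹' (glInt 3 K : Set (GL (Fin 3) K))) ≠ ∞ :=
    (hT.isClosedEmbedding_subtypeVal.isCompact_preimage (isCompact_glInt 3 K)).measure_lt_top.ne
  have hUeq : quotientMeasure ((epsCentralizer ε δ).subgroupOf A) t' (isClosed_subgroupOf (epsCentralizer ε δ) A hT) α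
        {z | descEpsConj ε δ (epsCentralizer ε δ) (fun m => iwasawaExp hϖ m) (inclQuot (epsCentralizer ε δ) A z) = iwasawaExp hϖ δ} =
      α {a : ↥A | (a : GL (Fin 3) K) ∈ glInt 3 K} / t (Subtype.val ⁻¹' (glInt 3 K : Set (GL (Fin 3) K))) :=
    (ENNReal.eq_div_iff ht0 ht0').2 (by rw [mul_comm]; exact hU)
  -- the product of the constants: `C · κ(K̃) μ_N(Ñ₀) · μAT(U₀) = ν(K̃) ∕ t(T ∩ K̃)`
  have hconst : (C : ℝ≥0∞) * (κ Set.univ * μN {u : ↥(upperUnitriangular (Fin 3) K) | (u : GL (Fin 3) K) ∈ glInt 3 K}) *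
      quotientMeasure ((epsCentralizer ε δ).subgroupOf A) t' (isClosed_subgroupOf (epsCentralizer ε δ) A hT) α
        {z | descEpsConj ε δ (epsCentralizer ε δ) (fun m => iwasawaExp hϖ m) (inclQuot (epsCentralizer ε δ) A z) = iwasawaExp hϖ δ} =
      ν (glInt 3 K : Set (GL (Fin 3) K)) / t (Subtype.val ⁻¹' (glInt 3 K : Set (GL (Fin 3) K))) := by
    rw [hUeq, ← mul_div_assoc, hpin]
  rw [← hconst]
  simp only [hG]
  ring

include hϖ hσ hσc hε hεΘ hεK hδ in
/-- **(V4-ONE) THE VALUE AT ROGAWSKI'S NORMALISATION** (`vol K̃ = 1`, `vol (T ∩ K̃) = 1`, §4.3): under `ν(K̃) = 1` and `t(T ∩ K̃) = 1`,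
**`∫⁻ 1_{K̃gK̃}(y δ ε(y)⁻¹) d(ν∕t)(y) = J(δ) · Σ'_{(n,m) ∈ ℤ × ℤ} #{γ ∈ K̃gK̃ ∕ K̃ : e(γ) = e(δ) + (n, 2m, n)}`** — no measure constant at all (§3 (V4-PIN)).
[cite: Rogawski1990, §4.3 (4.3.1) p. 43; §4.10 Prop. 4.10.2 proof p. 59] [cite: Kottwitz1986BaseChangeUnits, §3] -/
theorem lintegral_descEpsConj_indicator_doubleCoset_quotientMeasure_eq_of_measure_eq_one (hσ1 : ∃ x, σ x ≠ x)
    [T2Space (GL (Fin 3) K)] [SecondCountableTopology (GL (Fin 3) K)] [LocallyCompactSpace (GL (Fin 3) K)]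
    [IsHeckeTriple (⊤ : Submonoid (GL (Fin 3) K)) (glInt 3 K) (glInt 3 K)]
    (ha : d 2 / d 1 * σ (d 1 / d 0) - 1 ≠ 0) (hb : 1 - d 2 / d 0 * σ (d 2 / d 0) ≠ 0)
    {A : Subgroup (GL (Fin 3) K)} (hAid : A = standardLeviGL K (_root_.id : Fin 3 → Fin 3)) (hA : IsClosed (A : Set (GL (Fin 3) K)))
    (hT : IsClosed (epsCentralizer ε δ : Set (GL (Fin 3) K))) (hTA : epsCentralizer ε δ ≤ A)
    [MeasurableSpace (GL (Fin 3) K ⧸ epsCentralizer ε δ)] [BorelSpace (GL (Fin 3) K ⧸ epsCentralizer ε δ)]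
    [MeasurableSpace (GL (Fin 3) K ⧸ A)] [BorelSpace (GL (Fin 3) K ⧸ A)]
    [MeasurableSpace (↥A ⧸ (epsCentralizer ε δ).subgroupOf A)] [BorelSpace (↥A ⧸ (epsCentralizer ε δ).subgroupOf A)]
    (ν : Measure (GL (Fin 3) K)) [IsHaarMeasure ν] [ν.IsMulRightInvariant]
    (α : Measure ↥A) [IsHaarMeasure α] [α.IsMulRightInvariant] [α.IsInvInvariant]
    (t : Measure ↥(epsCentralizer ε δ)) [IsHaarMeasure t] [t.IsInvInvariant]
    (t' : Measure ↥((epsCentralizer ε δ).subgroupOf A)) [IsHaarMeasure t'] [t'.IsInvInvariant]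
    (ht' : t' = Measure.map (Subgroup.subgroupOfEquivOfLe hTA).symm t)
    (hν : ν (glInt 3 K : Set (GL (Fin 3) K)) = 1) (ht : t (Subtype.val ⁻¹' (glInt 3 K : Set (GL (Fin 3) K))) = 1) (g : GL (Fin 3) K) :
    ∫⁻ y, descEpsConj ε δ (epsCentralizer ε δ)
        (((glInt 3 K : Set (GL (Fin 3) K)) * {g} * (glInt 3 K : Set (GL (Fin 3) K))).indicator (1 : GL (Fin 3) K → ℝ≥0∞)) y
        ∂(quotientMeasure (epsCentralizer ε δ) t hT ν) =
      ((((normAbs K (d 2 / d 1 * σ (d 1 / d 0) - 1))⁻¹ * (NNReal.sqrt (normAbs K (1 - d 2 / d 0 * σ (d 2 / d 0))))⁻¹ : ℝ≥0)) : ℝ≥0∞) *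
        ∑' p : ℤ × ℤ, (#((finite_orbit_quotient (glInt 3 K) g).toFinset.filter
          fun γ => iwasawaExp hϖ γ.out = iwasawaExp hϖ δ + ![p.1, 2 * p.2, p.1]) : ℝ≥0∞) := by
  rw [lintegral_descEpsConj_indicator_doubleCoset_quotientMeasure_eq hϖ σ hσ hσc ε hε hεΘ hεK δ d hδ hσ1 ha hb hAid hA hT hTA ν α t t' ht' g,
    hν, ht, ENNReal.div_self one_ne_zero ENNReal.one_ne_top, one_mul]

end Value

end Summit.HodgeConjecture.HodgeConjecture.R90.S6

end
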